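import Mathlib
import HarnessLib
import Summits.QuantumAdvantage.QuantumAdvantage.Theorems.DigitDialB
import Summits.QuantumAdvantage.QuantumAdvantage.Theorems.DigitDialH

set_option linter.dupNamespace false
set_option autoImplicit false

/-!
# DigitDial (I) — EVERY strategy of polylog LINEAR RANK mod `M` (`3 ∤ M`) loses the odd-prime u-walk game: the `ℤ/M` form of
# R11′ (cell decomp-qadv, lens 4, g20 rev 4)

Prop-definition-free tree twin of §9b of the lens-4 g20 node `DigitDial` (supports item 23109: the polylog-linear-rank sub-case of
`WalkHardF` for every modulus coprime to `3`, not only the prime field).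
* `winCM`, `card_win_eq_sum_cellsM`, `main_term_leM` (junta strategies `z_δ`, `δ ∈ Γ_J^⊥`, bounded by `hiddenCoinsFour` WITH the junta),
  `norm_sum_char_shiftM`;
* `linStrat_card_win_le_junta`, `linStrat_card_win_le_rank` — `#WIN(linStrat λ tab) ≤ (3/4 + 3·M^K·cos(π/3M)^s)·2ⁿ` for ANY `K` forms
  mod ANY `M` coprime to `3` and ANY table, whenever `(log₂(M^K)+1)·s + 4 ≤ n`; `linStrat_card_win_le_rank_fin` (rate `7/8`,
  `s = 4M²(KM+4)`); `rank_junta_size_le`, `linRank_card_win_le_polylog` (`M, K ≤ (log₂ n)^C`, `n ≥ n₀(C)`); `wStrat_eq_linStrat`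
  (weight residues = rank one).  Ceiling of the method: `K ≈ √n/(M²·polylog)` (the `√n` wall of 23109).
0 sorry; axioms standard; no `instance`, no `notation`, no `native_decide`; no `def … : Prop`.
-/

noncomputable section

namespace Summit.QuantumAdvantage.QuantumAdvantage.Theorems.DigitDial

open Finset Summit.QuantumAdvantage.AdviceFreeQNC0 Literature.Computability.MetaComplexity
open TwistedTransfer ConstBells

section LinRankI

variable {n K : ℕ} {M : ℕ} [NeZero M]

/-- The win indicator of the constant strategy of cell `v`, as a complex number. -/
def winCM (c : ℕ) (tab : Fin (n + 1) → (Fin K → ZMod M) → Bool) (v : Fin K → ZMod M) (u : Fin n → Bool) : ℂ :=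
  if ringWinU c (fun g _ => decide (g ∈ cellY tab v)) u = true then 1 else 0

/-- **The win count split over the cells** (complex form). -/
theorem card_win_eq_sum_cellsM (c : ℕ) (lam : Fin K → Fin n → ZMod M) (tab : Fin (n + 1) → (Fin K → ZMod M) → Bool) :
    (((univ.filter fun u : Fin n → Bool => ringWinU c (linStrat lam tab) u = true).card : ℕ) : ℂ) =
      ∑ v : Fin K → ZMod M, ∑ u : Fin n → Bool, (if linVal lam u = v then winCM c tab v u else 0) := by
  classical
  rw [Finset.natCast_card_filter, Finset.sum_comm]
  refine Finset.sum_congr rfl fun u _ => ?_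
  rw [Finset.sum_ite_eq, if_pos (Finset.mem_univ _)]
  unfold winCM
  rw [ringWinU_linStrat_cell c lam tab rfl]

/-- **Main term**: if every `J`-junta strategy wins on `≤ θ·2ⁿ` inputs, then
`|Σ_v Σ_u [λ(u) − v ⊥ Γ_J]·[WIN_{Y_v}(u)]| ≤ |Γ_J^⊥|·θ·2ⁿ`. -/
theorem main_term_leM (lam : Fin K → Fin n → ZMod M) (J : Finset (Fin n)) (c : ℕ)
    (tab : Fin (n + 1) → (Fin K → ZMod M) → Bool) {θ : ℝ}
    (hJ : ∀ y : Fin (n + 1) → (Fin n → Bool) → Bool, (∀ g, ∀ u v : Fin n → Bool, (∀ i ∈ J, u i = v i) → y g u = y g v) →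
      ((univ.filter fun u : Fin n → Bool => ringWinU c y u = true).card : ℝ) ≤ θ * (2 : ℝ) ^ n) :
    ‖∑ v : Fin K → ZMod M, ∑ u : Fin n → Bool,
        (if (∀ γ ∈ gammaJ lam J, dotM γ (linVal lam u - v) = 0) then winCM c tab v u else 0)‖ ≤
      ((perp lam J).card : ℝ) * (θ * (2 : ℝ) ^ n) := by
  classical
  rw [Finset.sum_comm]
  simp_rw [sum_perp_cells_eq]
  rw [Finset.sum_comm]
  refine (norm_sum_le _ _).trans ?_
  have hδ : ∀ δ ∈ perp lam J, ‖∑ u : Fin n → Bool, winCM c tab (juntaVal lam J u + δ) u‖ ≤ θ * (2 : ℝ) ^ n := by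
    intro δ _
    have hwin : ∀ u : Fin n → Bool, winCM c tab (juntaVal lam J u + δ) u =
        (if ringWinU c (fun g u' => tab g (juntaVal lam J u' + δ)) u = true then (1 : ℂ) else 0) := by
      intro u
      unfold winCM
      rw [Summit.QuantumAdvantage.AdviceFreeQNC0.UnreadTwist.ringWinU_congr (c := c) (y := fun g _ => decide (g ∈ cellY tab (juntaVal lam J u + δ)))
        (y' := fun g u' => tab g (juntaVal lam J u' + δ)) (fun g => by unfold cellY; simp)]
    simp_rw [hwin]
    rw [← Finset.natCast_card_filter, Complex.norm_natCast]
    exact hJ _ (fun g u v huv => by rw [juntaVal_congr lam J huv])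
  calc (∑ δ ∈ perp lam J, ‖∑ u : Fin n → Bool, winCM c tab (juntaVal lam J u + δ) u‖)
      ≤ ∑ _δ ∈ perp lam J, θ * (2 : ℝ) ^ n := Finset.sum_le_sum hδ
    _ = ((perp lam J).card : ℝ) * (θ * (2 : ℝ) ^ n) := by rw [Finset.sum_const, nsmul_eq_mul]

/-- The twisted term of `γ` and cell `v` with the shift pulled out. [bookkeeping] -/
theorem norm_sum_char_shiftM (c : ℕ) (lam : Fin K → Fin n → ZMod M) (tab : Fin (n + 1) → (Fin K → ZMod M) → Bool)
    (γ v : Fin K → ZMod M) :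
    ‖∑ u : Fin n → Bool, (ZMod.stdAddChar (dotM γ (linVal lam u - v)) : ℂ) * winCM c tab v u‖ =
      ‖∑ u : Fin n → Bool, winCM c tab v u *
        (ZMod.stdAddChar (∑ i : Fin n, if u i then ∑ j, γ j * lam j i else 0) : ℂ)‖ := by
  have h : ∀ u : Fin n → Bool, (ZMod.stdAddChar (dotM γ (linVal lam u - v)) : ℂ) =
      (ZMod.stdAddChar (∑ i : Fin n, if u i then ∑ j, γ j * lam j i else 0) : ℂ) * ZMod.stdAddChar (dotM γ (-v)) := by
    intro u
    rw [sub_eq_add_neg, dotM_add_right, AddChar.map_add_eq_mul]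
    congr 2
    unfold dotM linVal
    exact TwoModuli.sum_mul_linForms_eq γ lam u
  simp_rw [h]
  rw [show (∑ u : Fin n → Bool, (ZMod.stdAddChar (∑ i : Fin n, if u i then ∑ j, γ j * lam j i else 0) : ℂ) *
      ZMod.stdAddChar (dotM γ (-v)) * winCM c tab v u) = ZMod.stdAddChar (dotM γ (-v)) *
      ∑ u : Fin n → Bool, winCM c tab v u *
        (ZMod.stdAddChar (∑ i : Fin n, if u i then ∑ j, γ j * lam j i else 0) : ℂ) from by
    rw [Finset.mul_sum]; exact Finset.sum_congr rfl fun u _ => by ring]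
  rw [norm_mul, AddChar.norm_apply, one_mul]

/-- **The `ℤ/M` R11′ with an explicit junta set**: `3 ∤ M`, `|J| + 4 ≤ n`, every `γ ∉ Γ_J` has `≥ s` non-zero coefficients
⇒ `#WIN(linStrat λ tab) ≤ (3/4)·2ⁿ + 3·M^K·cos(π/(3M))^s·2ⁿ`. -/
theorem linStrat_card_win_le_junta (hM3 : M.Coprime 3) (c : ℕ) (lam : Fin K → Fin n → ZMod M)
    (tab : Fin (n + 1) → (Fin K → ZMod M) → Bool) (J : Finset (Fin n)) (hJ4 : J.card + 4 ≤ n) {s : ℕ}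
    (hreg : ∀ γ : Fin K → ZMod M, γ ∉ gammaJ lam J → s ≤ (bsupp lam γ).card) :
    ((univ.filter fun u : Fin n → Bool => ringWinU c (linStrat lam tab) u = true).card : ℝ) ≤
      (3 / 4) * (2 : ℝ) ^ n + 3 * (M : ℝ) ^ K * Real.cos (Real.pi / (3 * M)) ^ s * (2 : ℝ) ^ n := by
  classical
  set ρ : ℝ := Real.cos (Real.pi / (3 * M)) with hρ
  have hρ0 : 0 ≤ ρ := TwistM.cos_nonneg M
  have hρ1 : ρ ≤ 1 := Real.cos_le_one _
  set Γ := gammaJ lam J with hΓ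
  set E : ℝ := 3 * ρ ^ s * (2 : ℝ) ^ n with hE
  have hE0 : 0 ≤ E := by positivity
  -- the junta bound (hidden coins `J_4` with the junta `J`)
  have hJ : ∀ y : Fin (n + 1) → (Fin n → Bool) → Bool, (∀ g, ∀ u v : Fin n → Bool, (∀ i ∈ J, u i = v i) → y g u = y g v) →
      ((univ.filter fun u : Fin n → Bool => ringWinU c y u = true).card : ℝ) ≤ (3 / 4) * (2 : ℝ) ^ n :=
    fun y hy => hiddenCoinsFour n c J hJ4 y hy
  -- per-cell twisted terms
  have hterm : ∀ (v γ : Fin K → ZMod M), γ ∉ Γ →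
      ‖∑ u : Fin n → Bool, (ZMod.stdAddChar (dotM γ (linVal lam u - v)) : ℂ) * winCM c tab v u‖ ≤ E := by
    intro v γ hγ
    rw [norm_sum_char_shiftM]
    unfold winCM
    refine (TwistM.corr_win_le hρ0 (fun b hb w => TwistM.site_contract hM3 hb w) c (cellY tab v)
      (fun i => ∑ j, γ j * lam j i)).trans ?_
    have : ρ ^ (univ.filter fun i : Fin n => (∑ j, γ j * lam j i) ≠ 0).card ≤ ρ ^ s :=
      pow_le_pow_of_le_one hρ0 hρ1 (hreg γ hγ)
    have h2n : (0 : ℝ) ≤ (2 : ℝ) ^ n := by positivity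
    rw [hE]
    nlinarith
  -- the split of every cell
  have hsplit : ∀ (v : Fin K → ZMod M) (u : Fin n → Bool),
      (if linVal lam u = v then winCM c tab v u else 0) =
        ((M : ℂ) ^ K)⁻¹ * (Γ.card : ℂ) *
          (if (∀ γ ∈ Γ, dotM γ (linVal lam u - v) = 0) then winCM c tab v u else 0) +
        ((M : ℂ) ^ K)⁻¹ * ∑ γ ∈ univ.filter (fun γ => γ ∉ Γ),
          (ZMod.stdAddChar (dotM γ (linVal lam u - v)) : ℂ) * winCM c tab v u := by
    intro v u
    have h1 : (if linVal lam u = v then winCM c tab v u else 0) =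
        (if linVal lam u - v = 0 then (1 : ℂ) else 0) * winCM c tab v u := by
      by_cases hv : linVal lam u = v
      · rw [if_pos hv, if_pos (sub_eq_zero.mpr hv), one_mul]
      · rw [if_neg hv, if_neg (fun h => hv (sub_eq_zero.mp h)), zero_mul]
    rw [h1, ite_eq_zero_split lam J (linVal lam u - v), add_mul]
    congr 1
    · split_ifs <;> ring
    · rw [mul_assoc, Finset.sum_mul]
  -- assemble
  have hmain := main_term_leM lam J c tab hJ
  have hcardId := card_gammaJ_mul_card_perp lam J
  have hpK : (M : ℝ) ^ K ≠ 0 := pow_ne_zero _ (by exact_mod_cast NeZero.ne M)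
  have htot := card_win_eq_sum_cellsM c lam tab
  have hdecomp : (∑ v : Fin K → ZMod M, ∑ u : Fin n → Bool, (if linVal lam u = v then winCM c tab v u else 0)) =
      ((M : ℂ) ^ K)⁻¹ * (Γ.card : ℂ) * (∑ v : Fin K → ZMod M, ∑ u : Fin n → Bool,
        (if (∀ γ ∈ Γ, dotM γ (linVal lam u - v) = 0) then winCM c tab v u else 0)) +
      ((M : ℂ) ^ K)⁻¹ * ∑ v : Fin K → ZMod M, ∑ γ ∈ univ.filter (fun γ => γ ∉ Γ),
        ∑ u : Fin n → Bool, (ZMod.stdAddChar (dotM γ (linVal lam u - v)) : ℂ) * winCM c tab v u := by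
    simp_rw [hsplit, Finset.sum_add_distrib]
    congr 1
    · rw [Finset.mul_sum]
      refine Finset.sum_congr rfl fun v _ => ?_
      rw [Finset.mul_sum]
    · rw [Finset.mul_sum]
      refine Finset.sum_congr rfl fun v _ => ?_
      rw [← Finset.mul_sum, Finset.sum_comm]
  have hcardM : (Finset.univ : Finset (Fin K → ZMod M)).card = M ^ K := by
    rw [Finset.card_univ, Fintype.card_fun, ZMod.card, Fintype.card_fin]
  have herr : ‖∑ v : Fin K → ZMod M, ∑ γ ∈ univ.filter (fun γ => γ ∉ Γ),
      ∑ u : Fin n → Bool, (ZMod.stdAddChar (dotM γ (linVal lam u - v)) : ℂ) * winCM c tab v u‖ ≤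
      (M : ℝ) ^ K * ((M : ℝ) ^ K * E) := by
    refine (norm_sum_le _ _).trans ?_
    have hv : ∀ v : Fin K → ZMod M, ‖∑ γ ∈ univ.filter (fun γ => γ ∉ Γ),
        ∑ u : Fin n → Bool, (ZMod.stdAddChar (dotM γ (linVal lam u - v)) : ℂ) * winCM c tab v u‖ ≤ (M : ℝ) ^ K * E := by
      intro v
      refine (norm_sum_le _ _).trans ?_
      calc (∑ γ ∈ univ.filter (fun γ => γ ∉ Γ),
            ‖∑ u : Fin n → Bool, (ZMod.stdAddChar (dotM γ (linVal lam u - v)) : ℂ) * winCM c tab v u‖)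
          ≤ ∑ γ ∈ univ.filter (fun γ => γ ∉ Γ), E := Finset.sum_le_sum fun γ hγ => hterm v γ (mem_filter.1 hγ).2
        _ ≤ (M : ℝ) ^ K * E := by
            rw [Finset.sum_const, nsmul_eq_mul]
            have : ((univ.filter (fun γ : Fin K → ZMod M => γ ∉ Γ)).card : ℝ) ≤ (M : ℝ) ^ K := by
              have h1 := Finset.card_filter_le (univ : Finset (Fin K → ZMod M)) (fun γ => γ ∉ Γ)
              rw [hcardM] at h1
              exact_mod_cast h1
            nlinarith
    calc (∑ v : Fin K → ZMod M, ‖∑ γ ∈ univ.filter (fun γ => γ ∉ Γ),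
          ∑ u : Fin n → Bool, (ZMod.stdAddChar (dotM γ (linVal lam u - v)) : ℂ) * winCM c tab v u‖)
        ≤ ∑ _v : Fin K → ZMod M, (M : ℝ) ^ K * E := Finset.sum_le_sum fun v _ => hv v
      _ = (M : ℝ) ^ K * ((M : ℝ) ^ K * E) := by
          rw [Finset.sum_const, nsmul_eq_mul, hcardM]; push_cast; ring
  have hnorm : ((univ.filter fun u : Fin n → Bool => ringWinU c (linStrat lam tab) u = true).card : ℝ) =
      ‖(((univ.filter fun u : Fin n → Bool => ringWinU c (linStrat lam tab) u = true).card : ℕ) : ℂ)‖ := by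
    rw [Complex.norm_natCast]
  rw [hnorm, htot, hdecomp]
  refine (norm_add_le _ _).trans ?_
  have hA : ‖((M : ℂ) ^ K)⁻¹ * (Γ.card : ℂ) * (∑ v : Fin K → ZMod M, ∑ u : Fin n → Bool,
      (if (∀ γ ∈ Γ, dotM γ (linVal lam u - v) = 0) then winCM c tab v u else 0))‖ ≤ (3 / 4) * (2 : ℝ) ^ n := by
    rw [norm_mul, norm_mul, norm_inv, norm_pow, Complex.norm_natCast, Complex.norm_natCast]
    calc ((M : ℝ) ^ K)⁻¹ * (Γ.card : ℝ) * ‖∑ v : Fin K → ZMod M, ∑ u : Fin n → Bool,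
          (if (∀ γ ∈ Γ, dotM γ (linVal lam u - v) = 0) then winCM c tab v u else 0)‖
        ≤ ((M : ℝ) ^ K)⁻¹ * (Γ.card : ℝ) * (((perp lam J).card : ℝ) * ((3 / 4) * (2 : ℝ) ^ n)) :=
          mul_le_mul_of_nonneg_left hmain (by positivity)
      _ = (((M : ℝ) ^ K)⁻¹ * ((Γ.card : ℝ) * ((perp lam J).card : ℝ))) * ((3 / 4) * (2 : ℝ) ^ n) := by ring
      _ = (3 / 4) * (2 : ℝ) ^ n := by
          have hnat : Γ.card * (perp lam J).card = M ^ K := by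
            have h := hcardId; exact_mod_cast h
          have hreal : (Γ.card : ℝ) * ((perp lam J).card : ℝ) = (M : ℝ) ^ K := by exact_mod_cast hnat
          rw [hreal, inv_mul_cancel₀ hpK, one_mul]
  have hB : ‖((M : ℂ) ^ K)⁻¹ * ∑ v : Fin K → ZMod M, ∑ γ ∈ univ.filter (fun γ => γ ∉ Γ),
      ∑ u : Fin n → Bool, (ZMod.stdAddChar (dotM γ (linVal lam u - v)) : ℂ) * winCM c tab v u‖ ≤ (M : ℝ) ^ K * E := by
    rw [norm_mul, norm_inv, norm_pow, Complex.norm_natCast]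
    calc ((M : ℝ) ^ K)⁻¹ * ‖∑ v : Fin K → ZMod M, ∑ γ ∈ univ.filter (fun γ => γ ∉ Γ),
          ∑ u : Fin n → Bool, (ZMod.stdAddChar (dotM γ (linVal lam u - v)) : ℂ) * winCM c tab v u‖
        ≤ ((M : ℝ) ^ K)⁻¹ * ((M : ℝ) ^ K * ((M : ℝ) ^ K * E)) := mul_le_mul_of_nonneg_left herr (by positivity)
      _ = (M : ℝ) ^ K * E := by rw [← mul_assoc, inv_mul_cancel₀ hpK, one_mul]
  rw [hE] at hB
  linarith

/-- **Every strategy of linear rank `K` mod `M` loses** (`3 ∤ M`, no hypothesis on the forms):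
`#WIN(linStrat λ tab) ≤ (3/4 + 3·M^K·cos(π/(3M))^s)·2ⁿ` whenever `(log₂(M^K) + 1)·s + 4 ≤ n`. -/
theorem linStrat_card_win_le_rank (hM3 : M.Coprime 3) (c : ℕ) (lam : Fin K → Fin n → ZMod M)
    (tab : Fin (n + 1) → (Fin K → ZMod M) → Bool) {s : ℕ} (hn : (Nat.log 2 (M ^ K) + 1) * s + 4 ≤ n) :
    ((univ.filter fun u : Fin n → Bool => ringWinU c (linStrat lam tab) u = true).card : ℝ) ≤
      (3 / 4 + 3 * (M : ℝ) ^ K * Real.cos (Real.pi / (3 * M)) ^ s) * (2 : ℝ) ^ n := by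
  obtain ⟨J, hJ, hreg⟩ := exists_reg_junta lam s
  have h := linStrat_card_win_le_junta hM3 c lam tab J (by omega) hreg
  linarith

/-- **Finite form at rate `7/8`**: `s = 4M²(KM + 4)` (so `3M^K cos(π/3M)^s ≤ 1/8`, `pow_twist_small`). -/
theorem linStrat_card_win_le_rank_fin (hM3 : M.Coprime 3) (c : ℕ) (lam : Fin K → Fin n → ZMod M)
    (tab : Fin (n + 1) → (Fin K → ZMod M) → Bool)
    (hn : (Nat.log 2 (M ^ K) + 1) * (4 * M ^ 2 * (K * M + 4)) + 4 ≤ n) :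
    ((univ.filter fun u : Fin n → Bool => ringWinU c (linStrat lam tab) u = true).card : ℝ) ≤ (7 / 8) * (2 : ℝ) ^ n := by
  have h := linStrat_card_win_le_rank hM3 c lam tab hn
  have hsmall := pow_twist_small M K (4 * M ^ 2 * (K * M + 4)) (Nat.one_le_iff_ne_zero.2 (NeZero.ne M)) le_rfl
  have h2n : (0 : ℝ) ≤ (2 : ℝ) ^ n := by positivity
  nlinarith

end LinRankI

section LinRankAsymptoticG

variable {n : ℕ}

/-- Polylog bookkeeping: `(log₂(M^K) + 1)·4M²(KM+4) ≤ 40·L^{6C}` for `M, K ≤ L^C`, `1 ≤ L`. -/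
theorem rank_junta_size_le {L M K C : ℕ} (hL : 1 ≤ L) (hM : M ≤ L ^ C) (hK : K ≤ L ^ C) :
    (Nat.log 2 (M ^ K) + 1) * (4 * M ^ 2 * (K * M + 4)) ≤ 40 * L ^ (6 * C) := by
  have hLC : 1 ≤ L ^ C := Nat.one_le_pow _ _ hL
  -- `log₂(M^K) + 1 ≤ M^K`'s log is at most `K·M ≤ L^{2C}`; cruder: `log₂(M^K) < M^K` is useless, use `log₂ x ≤ x`:
  have hlog : Nat.log 2 (M ^ K) ≤ K * M := by
    -- `M^K ≤ 2^{K M}` since `M ≤ 2^M`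
    have hM2 : M ≤ 2 ^ M := Nat.lt_two_pow_self.le
    have : M ^ K ≤ 2 ^ (K * M) := by
      calc M ^ K ≤ (2 ^ M) ^ K := Nat.pow_le_pow_left hM2 K
        _ = 2 ^ (K * M) := by rw [← pow_mul, mul_comm]
    calc Nat.log 2 (M ^ K) ≤ Nat.log 2 (2 ^ (K * M)) := Nat.log_mono_right this
      _ = K * M := Nat.log_pow one_lt_two _
  have hKM : K * M ≤ L ^ (2 * C) := by
    calc K * M ≤ L ^ C * L ^ C := Nat.mul_le_mul hK hM
      _ = L ^ (2 * C) := by rw [← pow_add]; ring_nf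
  have hM2 : M ^ 2 ≤ L ^ (2 * C) := by
    calc M ^ 2 ≤ (L ^ C) ^ 2 := Nat.pow_le_pow_left hM 2
      _ = L ^ (2 * C) := by rw [← pow_mul]; ring_nf
  have hL2C : 1 ≤ L ^ (2 * C) := Nat.one_le_pow _ _ hL
  have h1 : Nat.log 2 (M ^ K) + 1 ≤ 2 * L ^ (2 * C) := by omega
  have h2 : K * M + 4 ≤ 5 * L ^ (2 * C) := by omega
  calc (Nat.log 2 (M ^ K) + 1) * (4 * M ^ 2 * (K * M + 4))
      ≤ (2 * L ^ (2 * C)) * (4 * L ^ (2 * C) * (5 * L ^ (2 * C))) := by gcongr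
    _ = 40 * L ^ (6 * C) := by
        have : L ^ (6 * C) = L ^ (2 * C) * L ^ (2 * C) * L ^ (2 * C) := by rw [← pow_add, ← pow_add]; ring_nf
        rw [this]; ring

/-- **Every strategy of polylog linear rank loses** (explicit, Prop-definition-free form of the node's `LinRankHardM`): for every
`C`, for `n ≥ n₀(C)`, every charge, every modulus `M ≤ (log₂ n)^C` with `3 ∤ M`, every `K ≤ (log₂ n)^C` linear forms mod `M`
and every table, `#WIN ≤ (7/8)·2ⁿ`. -/
theorem linRank_card_win_le_polylog (C : ℕ) : ∃ n₀ : ℕ, ∀ n ≥ n₀, ∀ c : ℕ, ∀ (M : ℕ) [NeZero M], M.Coprime 3 →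
    M ≤ (Nat.log 2 n) ^ C → ∀ (K : ℕ) (lam : Fin K → Fin n → ZMod M) (tab : Fin (n + 1) → (Fin K → ZMod M) → Bool),
      K ≤ (Nat.log 2 n) ^ C →
        ((univ.filter fun u : Fin n → Bool => ringWinU c (linStrat lam tab) u = true).card : ℝ) ≤ (7 / 8) * (2 : ℝ) ^ n := by
  obtain ⟨N, hN⟩ := Summit.QuantumAdvantage.AdviceFreeQNC0.DWalk.const_mul_logPow_le' 44 (6 * C)
  refine ⟨max N 2, fun n hn c M _ hM3 hMle K lam tab hK => ?_⟩
  have hNn : N ≤ n := le_trans (le_max_left _ _) hn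
  have hn2 : 2 ≤ n := le_trans (le_max_right _ _) hn
  have hL1 : 1 ≤ Nat.log 2 n := Nat.le_log_of_pow_le one_lt_two (by simpa using hn2)
  have hsize := rank_junta_size_le (C := C) hL1 hMle hK
  have hNn' := hN n hNn
  have hL6 : 1 ≤ Nat.log 2 n ^ (6 * C) := Nat.one_le_pow _ _ hL1
  have hfin : (Nat.log 2 (M ^ K) + 1) * (4 * M ^ 2 * (K * M + 4)) + 4 ≤ n := by
    have h44 : 40 * Nat.log 2 n ^ (6 * C) + 4 ≤ 44 * Nat.log 2 n ^ (6 * C) := by omega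
    exact le_trans (Nat.add_le_add_right hsize 4) (le_trans h44 hNn')
  exact linStrat_card_win_le_rank_fin hM3 c lam tab hfin

/-- The weight-residue strategies are the linear-rank-ONE strategies of the all-ones form (so `LinRankHardM ⇒ W`, up to the
bookkeeping of `n₀`): `wStrat h = linStrat (fun _ _ => 1) (fun g v => h g (v 0))`. [bookkeeping] -/
theorem wStrat_eq_linStrat {M : ℕ} [NeZero M] (h : Fin (n + 1) → ZMod M → Bool) :
    wStrat h = linStrat (fun (_ : Fin 1) (_ : Fin n) => (1 : ZMod M)) (fun g v => h g (v 0)) := by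
  funext g u
  rfl

end LinRankAsymptoticG

end Summit.QuantumAdvantage.QuantumAdvantage.Theorems.DigitDial
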